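import Summits.AtomisticToContinuum.Crystallization.Theses.ChessboardParticlePlanes
import Summits.AtomisticToContinuum.Crystallization.Theorems.ChessboardParticlePlanesLayerConfinedCompetitorsProjection
import Summits.AtomisticToContinuum.Crystallization.Theorems.ChargedEnergyGap.Negative.Periodisation
import Literature.MathematicalPhysics.StatisticalMechanics.LennardJonesClusters

/-!
# Route ChessboardParticlePlanes — item 6712 `LayerConfinedCompetitors`: laminar periodisation

Helper file for item `stmt-AtomisticToContinuum-6712` (`LayerConfinedCompetitors`): the route's own
derivation of the item from the crux `LjLaminarWindows` (stmt-6711), i.e. the full content of the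
glue item `LaminarPeriodisation` (stmt-6713), proved here with the crux as an explicit hypothesis:

`LayerConfined.layerConfinedCompetitors_of_ljLaminarWindows : LjLaminarWindows → LayerConfinedCompetitors`.

Steps.
1. `exists_window` — Lennard-Jones ground states exist for every `N`
   (`LennardJonesGroundStatesExist_holds`); `LjLaminarWindows` at tolerance `η`, excess `ε` and
   radius `L = max L₀ 1` gives, frequently in `N` (hence for some `N`), a window around a
   particle `i`; re-indexed along `S.orderEmbOfFin` (`S` = the particles within `L` of `x_i`),
   recentred and rotated by the isometry `A`, it is a `7/10`-separated configuration
   `w : Fin m → ℝ³`, `m = #S ≥ 1`, with heights `t j` in the `3/4`-separated set `T`,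
   `|w j ₂ − t j| ≤ η`, and `𝓔(w) ≤ (⨅_Q e(Q) + ε)·m` (the clause's double sum is
   `2𝓔(x ∘ f)`, `sum_sum_map_eq_two_mul_interactionEnergy`).
2. Projection `w′ j = w j + (t j − w j ₂)•e₂`: by the companion file
   `…LayerConfinedCompetitorsProjection` (`interactionEnergy_le_of_near`,
   `two_thirds_le_dist_of_near`) `w′` is `2/3`-separated with heights exactly `t j` and
   `𝓔(w′) ≤ 𝓔(w) + 55250 η m`.
3. Periodisation with the tree's cubic `ChargedEnergyGapNegative.periodise` (period
   `2Σ‖w′ⱼ‖ + 2`, images `≥ 2` apart where `V_LJ ≤ 0`): `e ≤ 𝓔(w′)/m`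
   (`energyPerParticle_periodise_le`); `le_dist_of_mem_points_periodise` and
   `le_abs_sub_of_mem_points_periodise` transfer the two class clauses from the motif to the
   whole point set (a period shifts heights by integer multiples of the period `≥ 2Σ‖w′ⱼ‖ + 2`).
With `η = min(1/60, ε/110500)` and excess `ε/2` in step 1 the competitor is within `ε` of `⨅_Q e(Q)`.
-/

/-! ## Window extraction, projection onto the planes, laminar periodisation -/

namespace Summit.AtomisticToContinuum.Crystallization.Theorems.LayerConfined

open Literature.MathematicalPhysics.StatisticalMechanics
open Summit.AtomisticToContinuum.Crystallization.Theses.ChessboardParticlePlanes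
open Summit.AtomisticToContinuum.Crystallization.Theorems.ChargedEnergyGapNegative
  (periodise periodUnit period period_pos motif_periodise two_le_dist_of_mem_points
    energyPerParticle_periodise_le Dsum Dsum_nonneg norm_le_Dsum exists_int_coord_of_mem_cubicLattice
    val_periodUnit)
open scoped BigOperators

/-- A linear isometry applied to differences from a common centre preserves pair distances.
[folklore] -/
theorem dist_map_sub_map_sub (A : EuclideanSpace ℝ (Fin 3) →ₗᵢ[ℝ] EuclideanSpace ℝ (Fin 3))
    (p q c : EuclideanSpace ℝ (Fin 3)) : dist (A (p - c)) (A (q - c)) = dist p q := by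
  rw [dist_eq_norm, ← map_sub, LinearIsometry.norm_map, dist_eq_norm]
  congr 1
  abel

/-- **One laminar window.** `LjLaminarWindows`, applied to any sequence of Lennard-Jones ground
states (which exists, `LennardJonesGroundStatesExist_holds`) at tolerance `η` and excess `ε`,
yields — after recentring at the distinguished particle and rotating by the isometry `A` — a
finite configuration `w` of `m ≥ 1` points of `ℝ³` which is `7/10`-separated, heights `t j` in a
`3/4`-separated set with `|w j ₂ − t j| ≤ η`, and `𝓔(w) ≤ (⨅_Q e(Q) + ε) · m` (the window's
double sum is `2𝓔` of the re-indexed sub-configuration, `sum_sum_map_eq_two_mul_interactionEnergy`).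
[folklore] -/
theorem exists_window (hwin : LjLaminarWindows) {η ε : ℝ} (hη : 0 < η) (hε : 0 < ε) :
    ∃ (m : ℕ) (w : Fin m → EuclideanSpace ℝ (Fin 3)) (t : Fin m → ℝ), 0 < m ∧
      (∀ j k, j ≠ k → (7 : ℝ) / 10 ≤ dist (w j) (w k)) ∧
      (∀ j k, t j ≠ t k → (3 : ℝ) / 4 ≤ |t j - t k|) ∧
      (∀ j, |w j 2 - t j| ≤ η) ∧
      interactionEnergy lennardJones w ≤
        ((⨅ Q : PeriodicConfiguration 3, Q.energyPerParticle lennardJones) + ε) * m := by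
  choose x hx using LennardJonesGroundStatesExist_holds
  obtain ⟨L₀, hL₀⟩ := hwin x hx η ε hη hε
  obtain ⟨N, i, A, T, hT, hsep, hnear, hE⟩ := (hL₀ (max L₀ 1) (le_max_left _ _)).exists
  set L : ℝ := max L₀ 1 with hL
  have hL0 : (0 : ℝ) ≤ L := le_trans zero_le_one (le_max_right _ _)
  set S : Finset (Fin N) := Finset.univ.filter fun j => dist (x N j) (x N i) ≤ L with hS
  have hiS : i ∈ S := by
    rw [hS, Finset.mem_filter]
    exact ⟨Finset.mem_univ _, by rw [dist_self]; exact hL0⟩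
  have hm : 0 < S.card := Finset.card_pos.2 ⟨i, hiS⟩
  set f : Fin S.card ↪o Fin N := S.orderEmbOfFin rfl with hf
  have hfS : ∀ j, f j ∈ S := fun j => Finset.orderEmbOfFin_mem S rfl j
  have hfd : ∀ j, dist (x N (f j)) (x N i) ≤ L := fun j => (Finset.mem_filter.1 (hfS j)).2
  have ht : ∀ j, ∃ t ∈ T, |(A (x N (f j) - x N i)) 2 - t| ≤ η := fun j => hnear (f j) (hfd j)
  choose t htT htnear using ht
  refine ⟨S.card, fun j => A (x N (f j) - x N i), t, hm, ?_, ?_, htnear, ?_⟩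
  · intro j k hjk
    rw [dist_map_sub_map_sub]
    exact hsep (f j) (f k) (fun h => hjk (f.injective h)) (hfd j) (hfd k)
  · intro j k hjk
    exact hT (t j) (htT j) (t k) (htT k) hjk
  · -- the energy clause
    have hcard : (Nat.card {j : Fin N // dist (x N j) (x N i) ≤ L} : ℝ) = S.card := by
      rw [Nat.card_eq_fintype_card, Fintype.card_subtype]
    have hpt : ∀ j k : Fin N,
        (if j ≠ k ∧ dist (x N j) (x N i) ≤ L ∧ dist (x N k) (x N i) ≤ L then
          lennardJones (dist (x N j) (x N k)) else 0) =
        if j ∈ S then (if k ∈ S then lennardJones (dist (x N j) (x N k)) else 0) else 0 := by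
      intro j k
      simp only [hS, Finset.mem_filter, Finset.mem_univ, true_and]
      by_cases hjk : j = k
      · subst hjk
        simp [lennardJones_zero]
      · by_cases hj : dist (x N j) (x N i) ≤ L <;> by_cases hk : dist (x N k) (x N i) ≤ L <;>
          simp [hjk, hj, hk]
    have hLHS : (∑ j, ∑ k, if j ≠ k ∧ dist (x N j) (x N i) ≤ L ∧ dist (x N k) (x N i) ≤ L then
          lennardJones (dist (x N j) (x N k)) else 0) =
        ∑ j ∈ S, ∑ k ∈ S, lennardJones (dist (x N j) (x N k)) := by
      calc (∑ j, ∑ k, if j ≠ k ∧ dist (x N j) (x N i) ≤ L ∧ dist (x N k) (x N i) ≤ L then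
              lennardJones (dist (x N j) (x N k)) else 0)
          = ∑ j, ∑ k, (if j ∈ S then (if k ∈ S then lennardJones (dist (x N j) (x N k)) else 0)
              else 0) := Finset.sum_congr rfl fun j _ => Finset.sum_congr rfl fun k _ => hpt j k
        _ = ∑ j, (if j ∈ S then ∑ k, (if k ∈ S then lennardJones (dist (x N j) (x N k)) else 0)
              else 0) := by
            refine Finset.sum_congr rfl fun j _ => ?_
            split_ifs <;> simp
        _ = ∑ j ∈ S, ∑ k ∈ S, lennardJones (dist (x N j) (x N k)) := by
            rw [Finset.sum_ite_mem, Finset.univ_inter]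
            refine Finset.sum_congr rfl fun j _ => ?_
            rw [Finset.sum_ite_mem, Finset.univ_inter]
    have hSS : ∑ j ∈ S, ∑ k ∈ S, lennardJones (dist (x N j) (x N k)) =
        2 * interactionEnergy lennardJones (x N ∘ f) := by
      have h := sum_sum_map_eq_two_mul_interactionEnergy lennardJones lennardJones_zero (x N)
        f.toEmbedding
      rw [show Finset.univ.map f.toEmbedding = S from by
        rw [hf]; exact Finset.map_orderEmbOfFin_univ S rfl] at h
      exact h
    have hEw : interactionEnergy lennardJones (fun j => A (x N (f j) - x N i)) =
        interactionEnergy lennardJones (x N ∘ f) := by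
      unfold interactionEnergy
      refine Finset.sum_congr rfl fun j _ => Finset.sum_congr rfl fun k _ => ?_
      rw [dist_map_sub_map_sub]
      rfl
    rw [hLHS, hSS, hcard] at hE
    rw [hEw]
    linarith

variable {m : ℕ}

/-- **All points of the cubic periodisation are separated.** If the motif `x` (`m ≥ 1` points)
is `δ`-separated with `δ ≤ 2`, then so is the point set of `periodise x` (period
`2Σ‖xᵢ‖ + 2`): a pair of points is, up to a common period, a motif point and another point, which
is either another motif point (`≥ δ`) or a far image (`≥ 2`, `two_le_dist_of_mem_points`).
[folklore] -/
theorem le_dist_of_mem_points_periodise {x : Fin m → EuclideanSpace ℝ (Fin 3)} (hN : 0 < m)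
    {δ : ℝ} (hδ2 : δ ≤ 2) (hsep : ∀ j k, j ≠ k → δ ≤ dist (x j) (x k))
    {p q : EuclideanSpace ℝ (Fin 3)} (hp : p ∈ (periodise x (periodUnit x) le_rfl hN).points)
    (hq : q ∈ (periodise x (periodUnit x) le_rfl hN).points) (hpq : p ≠ q) : δ ≤ dist p q := by
  set P := periodise x (periodUnit x) le_rfl hN with hP
  obtain ⟨y, hy, g, hg, rfl⟩ := hp
  obtain ⟨y', hy', g', hg', rfl⟩ := hq
  rw [hP, motif_periodise] at hy hy'
  obtain ⟨j, -, rfl⟩ := Finset.mem_image.1 hy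
  obtain ⟨k, -, rfl⟩ := Finset.mem_image.1 hy'
  have hz : x k + (g' - g) ∈ P.points :=
    P.add_mem_points (P.mem_points_of_mem_motif (by
      rw [hP, motif_periodise]; exact Finset.mem_image_of_mem x (Finset.mem_univ k)))
      (P.lattice.sub_mem hg' hg)
  have hdist : dist (x j + g) (x k + g') = dist (x j) (x k + (g' - g)) := by
    rw [dist_eq_norm, dist_eq_norm]
    congr 1
    abel
  rw [hdist]
  by_cases hex : ∃ l, x k + (g' - g) = x l
  · obtain ⟨l, hl⟩ := hex
    rw [hl]
    refine hsep j l ?_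
    rintro rfl
    apply hpq
    have : x k + g' = x j + g := by
      rw [← hl]
      abel
    rw [this]
  · push Not at hex
    exact hδ2.trans (two_le_dist_of_mem_points x (periodUnit x) le_rfl hN j hz hex)

/-- **Heights of the cubic periodisation.** If the motif heights `xⱼ ₂` are pairwise `≥ 3/4`
apart when distinct, then so are the heights of all points of `periodise x`: a period changes
the height by `c·n`, `n ∈ ℤ`, `c = 2Σ‖xᵢ‖ + 2`, and `|xⱼ ₂ − x_k ₂| ≤ 2Σ‖xᵢ‖`. [folklore] -/
theorem le_abs_sub_of_mem_points_periodise {x : Fin m → EuclideanSpace ℝ (Fin 3)} (hN : 0 < m)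
    (hT : ∀ j k, x j 2 ≠ x k 2 → (3 : ℝ) / 4 ≤ |x j 2 - x k 2|)
    {p q : EuclideanSpace ℝ (Fin 3)} (hp : p ∈ (periodise x (periodUnit x) le_rfl hN).points)
    (hq : q ∈ (periodise x (periodUnit x) le_rfl hN).points) (hpq : p 2 ≠ q 2) :
    (3 : ℝ) / 4 ≤ |p 2 - q 2| := by
  set P := periodise x (periodUnit x) le_rfl hN with hP
  obtain ⟨y, hy, g, hg, rfl⟩ := hp
  obtain ⟨y', hy', g', hg', rfl⟩ := hq
  rw [hP, motif_periodise] at hy hy'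
  obtain ⟨j, -, rfl⟩ := Finset.mem_image.1 hy
  obtain ⟨k, -, rfl⟩ := Finset.mem_image.1 hy'
  obtain ⟨n, hn⟩ := exists_int_coord_of_mem_cubicLattice (periodUnit x) hg 2
  obtain ⟨n', hn'⟩ := exists_int_coord_of_mem_cubicLattice (periodUnit x) hg' 2
  rw [val_periodUnit] at hn hn'
  have h2 : ∀ u v : EuclideanSpace ℝ (Fin 3), (u + v) 2 = u 2 + v 2 := fun u v => rfl
  rw [h2, h2, hn, hn'] at hpq ⊢
  by_cases hnn : n = n'
  · subst hnn
    have hne : x j 2 ≠ x k 2 := fun h => hpq (by rw [h])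
    have := hT j k hne
    rwa [show x j 2 + period x * ↑n - (x k 2 + period x * ↑n) = x j 2 - x k 2 by ring]
  · have h1 : (1 : ℝ) ≤ |(n : ℝ) - n'| := by
      rw [← Int.cast_sub, ← Int.cast_abs]
      exact_mod_cast Int.one_le_abs (sub_ne_zero.2 hnn)
    have hj : |x j 2| ≤ Dsum x := le_trans (by simpa using PiLp.norm_apply_le (x j) 2) (norm_le_Dsum x j)
    have hk : |x k 2| ≤ Dsum x := le_trans (by simpa using PiLp.norm_apply_le (x k) 2) (norm_le_Dsum x k)
    have hper : period x = 2 * Dsum x + 2 := rfl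
    have hD := Dsum_nonneg x
    have key : period x * |(n : ℝ) - n'| - (|x j 2| + |x k 2|) ≤
        |x j 2 + period x * n - (x k 2 + period x * n')| := by
      have e : x j 2 + period x * n - (x k 2 + period x * n') =
          period x * (n - n') + (x j 2 - x k 2) := by ring
      rw [e]
      have t1 := abs_sub_abs_le_abs_sub (period x * (n - n')) (-(x j 2 - x k 2))
      rw [sub_neg_eq_add, abs_neg, abs_mul, abs_of_pos (period_pos x)] at t1
      have t2 := abs_sub (x j 2) (x k 2)
      linarith
    have hprod : period x * 1 ≤ period x * |(n : ℝ) - n'| :=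
      mul_le_mul_of_nonneg_left h1 (period_pos x).le
    linarith

/-- **Laminar periodisation** (the content of item 6713 `LaminarPeriodisation`, stated with the
hypothesis `LjLaminarWindows` explicit): `LjLaminarWindows → LayerConfinedCompetitors`.
Given `ε > 0` put `η = min(1/60, ε/110500)`; take a laminar window `w` with
`𝓔(w) ≤ (⨅e + ε/2)·m` (`exists_window`), move each particle onto its plane
(`w′ⱼ = wⱼ + (tⱼ − wⱼ ₂) e₂`: `2/3`-separated, heights in the `3/4`-separated set, energy
`≤ 𝓔(w) + 55250 η m ≤ (⨅e + ε)·m` by `interactionEnergy_le_of_near`), and periodise `w′` with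
the cubic lattice of period `2Σ‖w′ⱼ‖ + 2` (`periodise`: images `≥ 2` apart where `V_LJ ≤ 0`, so
`e ≤ 𝓔(w′)/m`, `energyPerParticle_periodise_le`). [folklore] -/
theorem layerConfinedCompetitors_of_ljLaminarWindows (hwin : LjLaminarWindows) :
    LayerConfinedCompetitors := by
  intro ε hε
  set η : ℝ := min (1 / 60) (ε / 110500) with hη
  have hη0 : 0 < η := lt_min (by norm_num) (by positivity)
  have hη60 : η ≤ 1 / 60 := min_le_left _ _
  have hηε : 55250 * η ≤ ε / 2 := by
    have := min_le_right (1 / 60 : ℝ) (ε / 110500)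
    linarith
  obtain ⟨m, w, t, hm, hsep, hT, hnear, hE⟩ := exists_window hwin hη0 (half_pos hε)
  -- the projected configuration
  set w' : Fin m → EuclideanSpace ℝ (Fin 3) :=
    fun j => w j + (t j - w j 2) • EuclideanSpace.single 2 1 with hw'
  have hw'2 : ∀ j, w' j 2 = t j := by
    intro j
    simp [hw']
  have hmove : ∀ j, dist (w' j) (w j) ≤ η := by
    intro j
    rw [dist_eq_norm]
    simp only [hw', add_sub_cancel_left, norm_smul, PiLp.norm_single, norm_one, mul_one,
      Real.norm_eq_abs]
    rw [abs_sub_comm]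
    exact hnear j
  have hnear2 : ∀ j k, |dist (w' j) (w' k) - dist (w j) (w k)| ≤ 2 * η :=
    abs_dist_sub_dist_le hmove
  have hsep' : ∀ j k, j ≠ k → (2 : ℝ) / 3 ≤ dist (w' j) (w' k) := fun j k hjk =>
    two_thirds_le_dist_of_near hη60 hsep hnear2 hjk
  have hinj : Function.Injective w' := by
    intro j k hjk
    by_contra hne
    have := hsep' j k hne
    rw [hjk, dist_self] at this
    linarith
  have hT' : ∀ j k, w' j 2 ≠ w' k 2 → (3 : ℝ) / 4 ≤ |w' j 2 - w' k 2| := by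
    intro j k hjk
    rw [hw'2, hw'2] at hjk ⊢
    exact hT j k hjk
  have hmr : (0 : ℝ) ≤ m := Nat.cast_nonneg m
  have hE' : interactionEnergy lennardJones w' ≤
      ((⨅ Q : PeriodicConfiguration 3, Q.energyPerParticle lennardJones) + ε) * m := by
    have h1 := interactionEnergy_le_of_near hη60 hsep hnear2 (w' := w')
    have h2 : 55250 * η * m ≤ ε / 2 * m := mul_le_mul_of_nonneg_right hηε hmr
    nlinarith
  refine ⟨periodise w' (periodUnit w') le_rfl hm, ?_, ?_, ?_⟩
  · exact fun p hp q hq hpq => le_dist_of_mem_points_periodise hm (by norm_num) hsep' hp hq hpq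
  · exact fun p hp q hq hpq => le_abs_sub_of_mem_points_periodise hm hT' hp hq hpq
  · have hmr' : (0 : ℝ) < m := by exact_mod_cast hm
    calc (periodise w' (periodUnit w') le_rfl hm).energyPerParticle lennardJones
        ≤ interactionEnergy lennardJones w' / m :=
          energyPerParticle_periodise_le hinj (periodUnit w') le_rfl hm
      _ ≤ (⨅ Q : PeriodicConfiguration 3, Q.energyPerParticle lennardJones) + ε := by
          rw [div_le_iff₀ hmr']
          exact hE'

/-- **Item 6713 `LaminarPeriodisation`, by name**: `LjLaminarWindows → LayerConfinedCompetitors` is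
literally the route decl `LaminarPeriodisation`; this is `layerConfinedCompetitors_of_ljLaminarWindows`.
[folklore] -/
theorem laminarPeriodisation_proof : LaminarPeriodisation :=
  fun hwin => layerConfinedCompetitors_of_ljLaminarWindows hwin

end Summit.AtomisticToContinuum.Crystallization.Theorems.LayerConfined
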